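import Summits.CriticalPhenomena.PercolationContinuityZ3.Theorems.PercNearOneGluingNoHeavyPcintMeanMemZ5M10Defs
import HarnessLib

/-!
# PCINT lane, kernel reduced-state B3m certificate `Z5M10` (bond, d = 5, memory τ = 10, kc = 4, 6192 state classes): row checks 7 (rows [6000, 6192))

Cell `prim-pcint`, seat `prim-pcint-2` (gen 4); memo `run/shared/lean/prim/pcint/REDUCTIONS.md` §B3m and HANDOFF ("B3m on reduced states").
Does NOT build on p205010.  Data for `BondK.le_criticalProb_of_checkRowsM` (`…PcintMeanMemKernelCert`): `p = 11520/100000`, chain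
parameter `kc = 4`, `s̄ = 99335/100000` (`s̄²+p² ≥ 1`), `t̄ = 97620/100000` (`(1-p)(1+2p) ≤ t̄(1+p)`, `1-p ≤ s̄ t̄²`, `t̄ ≤ s̄²`), `t̄' = 98811/100000`
(`p² ≤ (t̄'-t̄)(1+p)`), mean corner-third unit `m̄ = 98216/100000 ≥ (t̄+t̄')/2`, `κ̄ = (100000²+99335²)/(2·100000²)`, `λ = 99999/100000`; Collatz–Wielandt
weights (scale 10⁹) from a power iteration (ρ ≈ 0.9995953), exact off-line max row ratio 0.9995952900 < λ.  Generated by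
work/gen/gen_b3m_kernel.py (prim-pcint-2 gen 4 folder; copy in run/shared/lean/prim/pcint/prim-pcint-2/kernel/); the kernel re-checks every row.
-/

namespace Summit.CriticalPhenomena.PercolationContinuityZ3.Theorems.Pcint.MeanMemZ5M10

set_option maxHeartbeats 0 in
/-- Rows `[6000, 6100)` pass the check. [folklore] -/
theorem chk_6000 : WinK.allRange (BondK.checkRowM 10 4 5 6192 11520 99335 97620 98216 100000 99999 100000 MeanMemZ5M10.syms MeanMemZ5M10.tree) 6000 6100 = true :=
  WinK.allRange_of_allRangeB (fuel := 8) (lo := 6000) (len := 100) (by decide +kernel)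

set_option maxHeartbeats 0 in
/-- Rows `[6100, 6192)` pass the check. [folklore] -/
theorem chk_6100 : WinK.allRange (BondK.checkRowM 10 4 5 6192 11520 99335 97620 98216 100000 99999 100000 MeanMemZ5M10.syms MeanMemZ5M10.tree) 6100 6192 = true :=
  WinK.allRange_of_allRangeB (fuel := 8) (lo := 6100) (len := 92) (by decide +kernel)

/-- Rows `[6000, 6192)` pass the check. [folklore] -/
theorem file_7 : WinK.allRange (BondK.checkRowM 10 4 5 6192 11520 99335 97620 98216 100000 99999 100000 MeanMemZ5M10.syms MeanMemZ5M10.tree) 6000 6192 = true := (WinK.allRange_split chk_6000 chk_6100)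

end Summit.CriticalPhenomena.PercolationContinuityZ3.Theorems.Pcint.MeanMemZ5M10
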